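import Summits.BirchSwinnertonDyer.Rank1Residual.X1.KellerYinIMC2Halves
import Summits.BirchSwinnertonDyer.Rank1Residual.X11b.EmbeddingDatumPrime
import Literature.NumberTheory.EllipticCurves.CastellaHsieh2018.BDPLFunctionExistence
import Literature.NumberTheory.EllipticCurves.ModularityVersionApProofs
import Literature.FieldTheory.AlgClosed.PadicAlgClEquivComplex
import HarnessLib

/-!
# Keller–Yin Thm. 3.0.8 at the good lattice — the existence input H1 DISCHARGED from print
# (Castella–Hsieh 2018 Def. 3.5 + Prop. 3.6), so `h308 ⇐ {PUB fact, L-div, L-μλ, L-val}`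
# (cell `bsd-eis`, `run/shared/lean/pub/bsd-eis/`; seat `bsd-eis-ky` gen 5; THEOREMS ONLY)

HONEST FRAMING (FULL-BSD rank-≤1 programme D-0033, row A1 = class X1 ∩ {`r_an = 1`, type A},
7 892 census cells). `X1/KellerYinIMC2Halves.lean` reduces THEOREM A's one preprint input `h308`
to four typed inputs (H1 existence, L-div, L-μλ, L-val). Here H1 (`GoodBDPExistsOnTree W p`) is
PROVED from the registered PUBLISHED fact
`Literature.NumberTheory.EllipticCurves.castellaHsieh2018_exists_isBDPLFunction` (Castella–Hsieh,
Math. Ann. 370 (2018) Def. 3.5 + Prop. 3.6: the BDP `p`-adic `L`-function at an odd GOOD prime split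
in `K`, no image hypothesis) and Carayol's theorem (the newform's level is the conductor, tree named
fact `IsNewformOf.level_eq_conductorNorm`), through the class-X11b glue (`exists_datum_forall_mem_iff`:
an embedding datum `ι' : ℚ̄_p ≃ ℂ` inducing the prime `v` of `ι`). Hence
`thm308_of_castellaHsieh2018_of_halves`: `h308` from {CH18 existence (PUB), Carayol (PUB), L-div
(PUB∘ shape), L-μλ (PRE — Keller–Yin's new content), L-val (PUB shape)}. Nothing asserted; no label
moves; every consumer CONDITIONAL on the named inputs.

References: [CastellaHsieh2018] Def. 3.5, Prop. 3.6; [Carayol1986]; [KellerYin2024] Thm. 3.0.8;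
HOME/bsd-eis-ky-MEMO-5-PLAN.md §2 (i).
-/

set_option autoImplicit false

noncomputable section

open scoped Classical

open WeierstrassCurve NumberField IsDedekindDomain Field
  Literature.NumberTheory.EllipticCurves Literature.NumberTheory.EllipticCurves.ModularForms
  Literature.NumberTheory.QuadraticFields Literature.NumberTheory.EllipticCurves.Rank1Residual
  Literature.NumberTheory.EllipticCurves.KellerYin2024

namespace Summit.BirchSwinnertonDyer.Rank1Residual.X1.KellerYinHalves

/-- **H1 from print.** On the data of `h308` the BDP frame EXISTS: `p ∈ v` (`‖ι(p)‖ = p⁻¹ < 1`),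
an embedding datum `ι'` inducing `v` exists (`X11b.exists_datum_forall_mem_iff`), the level of
`Dt.f` is `N_W` (Carayol, `hC`), so `p ∤ N` (good reduction, `dvd_conductorNorm_iff_not_hasGoodReductionAtPrime`)
and (Heeg) for `N`; `p` splits in `K` (`SatisfiesHeegnerHypothesis p K`); then Castella–Hsieh 2018
Def. 3.5 + Prop. 3.6 (`hCH`) gives the frame. CONDITIONAL on the two named PUBLISHED facts.
[cite: CastellaHsieh2018, Def. 3.5 and Prop. 3.6 (arXiv:1505.08165 pp. 10–11)] [cite: Carayol1986] -/
theorem goodBDPExistsOnTree_of_castellaHsieh2018 (hCH : castellaHsieh2018_exists_isBDPLFunction)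
    (hC : ∀ (N : ℕ) [NeZero N], IsNewformOf.level_eq_conductorNorm (N := N))
    (W : WeierstrassCurve ℚ) [W.IsElliptic] [W.IsGloballyMinimal] (p : ℕ) [Fact p.Prime] :
    GoodBDPExistsOnTree W p := by
  intro hp hgood _hred _han _hGL K _ _ hK hHN hHp _hodd _h3 _hEK _hSel ι v vbar hv _hvbar _hne κ hκ γ _
    N _ Dt H ιC P _hP
  -- `p ∈ v`
  have hpv : ((p : ℕ) : 𝓞 K) ∈ v.asIdeal := by
    rw [hv]
    have h1 : ((((p : ℕ) : 𝓞 K) : K)) = (p : K) := by push_cast; rfl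
    rw [h1, map_natCast, Padic.norm_p]
    exact inv_lt_one_of_one_lt₀ (by exact_mod_cast (Fact.out : p.Prime).one_lt)
  -- an embedding datum inducing `v`
  obtain ⟨ι₀⟩ := PadicAlgCl.nonempty_ringEquiv_complex p
  obtain ⟨ι', -, hι'⟩ := X11b.exists_datum_forall_mem_iff p ι₀ hK hpv
  -- the level is the conductor: `p ∤ N` and (Heeg) for `N`
  have hN : N = W.conductorNorm ℤ := hC N Dt.isNewformOf
  have hpN : ¬ p ∣ N := by
    rw [hN, W.dvd_conductorNorm_iff_not_hasGoodReductionAtPrime p, not_not]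
    exact hgood
  have hHeeg : SatisfiesHeegnerHypothesis N K := by rw [hN]; exact hHN
  have hsplit : ((Ideal.span {(p : ℤ)}).primesOver (𝓞 K)).ncard = 2 := hHp p Fact.out (dvd_refl p)
  obtain ⟨ΩK, Ωp, L, hΩK, hL⟩ := hCH ι' W K v κ γ Dt.isNewformOf (by omega) hpN hK hsplit hpv hι' hHeeg
    hκ Fact.out
  exact ⟨ι', hι', ΩK, Ωp, L, hΩK, hL⟩

/-- **`h308` from PRINT + ONE preprint statement.** Castella–Hsieh 2018 existence (PUB fact) +
Carayol (PUB fact) + L-div (PUB∘ shape) + L-μλ (Keller–Yin Thm. 1.5.1 + 2.2.x — THE preprint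
content) + L-val (PUB shape) ⟹ `KellerYin2024.thm308_imc2_bdpValue_goodLattice_OPEN`.
CONDITIONAL on the named inputs; nothing booked, no label moves.
[cite: KellerYin2024, Thm. 3.0.8 (IMC2)] [cite: CastellaHsieh2018, Def. 3.5 and Prop. 3.6]
[cite: CastellaGrossiLeeSkinner2022, Prop. 4.2.1, Thm. 5.1.3] -/
theorem thm308_of_castellaHsieh2018_of_halves (hCH : castellaHsieh2018_exists_isBDPLFunction)
    (hC : ∀ (N : ℕ) [NeZero N], IsNewformOf.level_eq_conductorNorm (N := N))
    (hdiv : ∀ (W : WeierstrassCurve ℚ) [W.IsElliptic] [W.IsGloballyMinimal] (p : ℕ) [Fact p.Prime],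
      GoodLatticeDivOnTree W p)
    (hml : ∀ (W : WeierstrassCurve ℚ) [W.IsElliptic] [W.IsGloballyMinimal] (p : ℕ) [Fact p.Prime],
      GoodLatticeMuLambdaOnTree W p)
    (hval : ∀ (W : WeierstrassCurve ℚ) [W.IsElliptic] [W.IsGloballyMinimal] (p : ℕ) [Fact p.Prime],
      GoodBDPValueOnTree W p) :
    thm308_imc2_bdpValue_goodLattice_OPEN :=
  thm308_of_halves (fun W _ _ p _ ↦ goodBDPExistsOnTree_of_castellaHsieh2018 hCH hC W p) hdiv hml hval

end Summit.BirchSwinnertonDyer.Rank1Residual.X1.KellerYinHalves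

end
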